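import Literature.IUT.HodgeTheaters.CoveringsErrata
import Literature.AnabelianGeometry.SemiGraphs.GaloisLevelDataOfCharCores
import HarnessLib

/-!
# [IUTchI] Remark 2.5.3 (vi) (O1), PROVED for finite coherent semi-graphs of anabelioids

Mochizuki, *Inter-universal Teichmüller theory I*, kurims manuscript (May 2020), Remark 2.5.3 (vi) (O1),
p. 55 [cite: Mochizuki2012, IUTchI Rmk 2.5.3 (vi) (O1) p.55] (an ERRATUM to [SemiAnbd] Def. 5.1 (i); D-0012
claim key, the series being DISPUTED — the content of (O1) is classical group theory of [SemiAnbd] §2–§3,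
Prop. 3.6 p. 38, and takes no side):

> "(O1) Suppose that `𝒢` is finite. Then `𝒢` admits a cofinal, countable collection of connected finite
> étale Galois coverings `{𝒢_i → 𝒢}_{i ∈ I}`, each of which is characteristic [i.e., any pull-back of the
> covering via an element of `Aut(𝒢)` is isomorphic to the original covering]. [For instance, one verifies
> immediately, by applying the finiteness and coherence of `𝒢`, that such a collection of coverings may be
> obtained by considering, for `n` a positive integer, the composite of all connected finite étale Galois
> coverings of degree `≤ n`.]"

`CoveringsErrata.lean` (abc-iut-L5-t6) records (O1)/(O2) as NOTED, not typed ("typable only over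
abc-iut-L3-t1's finite-étale covering calculus").  That calculus now exists (abc-iut cell, layer L3): the
"composite of all connected finite étale [Galois] coverings of degree `≤ n`" is, at the profinite fundamental
group `π̂₁(𝒢) = Aut(𝒢.fiberAt v₀)` of the Galois category `B(𝒢)`, abc-iut-w4-d053's CHARACTERISTIC OPEN CORE
`charOpenCore (Aut (𝒢.fiberAt v₀)) n` (= the intersection of all open subgroups of index `≤ n`,
`CharacteristicOpenCore.lean`), and "the finiteness and coherence of `𝒢`" is exactly what makes it OPEN of
FINITE INDEX (abc-iut-w4-d048's T54·E1b `charOpenCore_autFiberAt_family`, `BoundedDegreeCoveringsFinite.lean`: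
finite semi-graph, topologically finitely generated vertex and edge groups — [SemiAnbd] Def. 2.3 (iii)).
PROOF-ONLY file (no definition, no named fact), seat abc-iut-w4-d048:

* `Rmk253.o1_characteristic_levels` — (O1) in GROUP form: an antitone sequence `N n` of OPEN NORMAL
  FINITE-INDEX subgroups of `π̂₁(𝒢)`, COFINAL among the open finite-index subgroups (= the connected finite
  étale coverings), each CHARACTERISTIC in the sense that every bi-continuous automorphism of `π̂₁(𝒢)`
  maps it to itself — through which `Aut(𝒢)` acts on `π̂₁(𝒢)` (up to inner automorphisms, which fix normal
  subgroups), so that the pull-back of the covering `𝒢_{N n}` by an element of `Aut(𝒢)` is isomorphic to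
  `𝒢_{N n}` (this last, covering-level reading of "characteristic" is stated here only in words);
* `Rmk253.o1_galois_tower` — (O1) in COVERING form: a countable projective system `𝒢̃ = (𝒢_{N n})_n` of
  connected finite étale GALOIS coverings (abc-iut-L3-t9's `GaloisLevelData`, via `GaloisLevelData.ofCharCores`,
  `GaloisLevelDataOfCharCores.lean`) whose `v₀`-base points have stabiliser exactly `charOpenCore _ n`, and
  which is COFINAL: every connected component of every tempered covering of `𝒢` is split by its levels from
  some level on.

(O2) (the profinite topology on `Aut(𝒢̃/𝒢)`) is not treated here.  Nothing in this file takes a side on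
[IUTchIII] Cor. 3.12; the hypotheses (`Prop36Hypotheses`, finiteness of the semi-graph, topological finite
generation of the vertex and edge groups) are the printed "finite" + "coherent" + the standing hypotheses of
[SemiAnbd] §3.
-/

namespace Literature.IUT.HodgeTheaters.Rmk253

open Literature.AnabelianGeometry.SemiGraphs Literature.AnabelianGeometry.SemiGraphs.ProfiniteSemiGraph
open Literature.AnabelianGeometry.AbsoluteAnabelian (IsTopologicallyFinitelyGenerated)
open CategoryTheory

universe u

variable {𝒢 : ProfiniteSemiGraph.{u}} [Finite 𝒢.graph.Vertex] [Finite 𝒢.graph.Branch]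

/-- **[IUTchI] Rmk 2.5.3 (vi) (O1), group form**: for a FINITE connected semi-graph of anabelioids with
topologically finitely generated vertex and edge groups (coherence), `π̂₁(𝒢) = Aut(𝒢.fiberAt v₀)` admits an
antitone sequence `N` of OPEN NORMAL FINITE-INDEX subgroups, each mapped to itself by EVERY bi-continuous
automorphism of `π̂₁(𝒢)` (characteristic), and COFINAL: every open subgroup of finite index (every connected
finite étale covering) contains some `N n` — namely `N n :=` the composite of all connected finite étale
coverings of degree `≤ n` (`charOpenCore`). [cite: Mochizuki2012, IUTchI Rmk 2.5.3 (vi) (O1) p.55] -/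
theorem o1_characteristic_levels (hc : 𝒢.graph.IsConnected) (v₀ : 𝒢.graph.Vertex)
    (hVt : ∀ v : 𝒢.graph.Vertex, IsTopologicallyFinitelyGenerated (𝒢.Gv v))
    (hEt : ∀ e : 𝒢.graph.Edge, IsTopologicallyFinitelyGenerated (𝒢.Ge e)) :
    ∃ N : ℕ → Subgroup (Aut (𝒢.fiberAt v₀)),
      Antitone N ∧
      (∀ n, IsOpen (N n : Set (Aut (𝒢.fiberAt v₀))) ∧ (N n).Normal ∧ (N n).FiniteIndex ∧
        ∀ φ : MulAut (Aut (𝒢.fiberAt v₀)), Continuous φ → Continuous φ.symm →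
          (N n).map φ.toMonoidHom = N n) ∧
      ∀ U : Subgroup (Aut (𝒢.fiberAt v₀)), IsOpen (U : Set (Aut (𝒢.fiberAt v₀))) → U.FiniteIndex →
        ∃ n, N n ≤ U :=
  ⟨fun n => charOpenCore (Aut (𝒢.fiberAt v₀)) n, charOpenCore_autFiberAt_family 𝒢 hc v₀ hVt hEt⟩

/-- **[IUTchI] Rmk 2.5.3 (vi) (O1), covering form**: under the same hypotheses and the standing hypotheses
of [SemiAnbd] Prop. 3.6, there is a countable projective system of connected finite étale GALOIS coverings
of `𝒢` (a `GaloisLevelData`: levels `S n` with transition maps) such that (a) the `v₀`-base point of the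
`n`-th level has stabiliser EXACTLY the characteristic open core `charOpenCore (Aut (𝒢.fiberAt v₀)) n` — so
the level "is" the composite of all connected finite étale Galois coverings of degree `≤ n`, a
CHARACTERISTIC covering —, and (b) the system is COFINAL: every connected component of every tempered
covering of `𝒢` is split by the levels `S m` for all large `m`. [cite: Mochizuki2012, IUTchI Rmk 2.5.3 (vi) (O1) p.55] -/
theorem o1_galois_tower (h36 : 𝒢.Prop36Hypotheses) (v₀ : 𝒢.graph.Vertex)
    (hVt : ∀ v : 𝒢.graph.Vertex, IsTopologicallyFinitelyGenerated (𝒢.Gv v))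
    (hEt : ∀ e : 𝒢.graph.Edge, IsTopologicallyFinitelyGenerated (𝒢.Ge e)) :
    ∃ D : ProfiniteSemiGraph.GaloisLevelData 𝒢,
      (∀ n, D.S n = 𝒢.ofBObj.obj (charCoreObj h36 v₀ hVt hEt n)) ∧
      (∀ n, MulAction.stabilizer (Aut (𝒢.fiberAt v₀))
          (@basePt 𝒢 h36.isConnected v₀ (charOpenCore (Aut (𝒢.fiberAt v₀)) n)
            (isOpen_charOpenCore_autFiberAt h36 v₀ hVt hEt n)
            (finiteIndex_charOpenCore_autFiberAt h36 v₀ hVt hEt n)) =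
        charOpenCore (Aut (𝒢.fiberAt v₀)) n) ∧
      ∀ (T : ProfiniteSemiGraph.CovObj 𝒢), T.IsTempered → ∀ p : T.Point,
        ∃ n : ℕ, ∀ m, n ≤ m → (D.S m).Splits (T.component p) :=
  ⟨GaloisLevelData.ofCharCores h36 v₀ hVt hEt, fun n => ofCharCores_S h36 v₀ hVt hEt n,
    fun n => stabilizer_basePt_charCoreObj h36 v₀ hVt hEt n,
    fun T hT p => ofCharCores_exists_level_splits_component h36 v₀ hVt hEt T hT p⟩

/-- The levels of the (O1) tower are GALOIS coverings (connected finite étale Galois objects of `B(𝒢)`).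
[cite: Mochizuki2012, IUTchI Rmk 2.5.3 (vi) (O1) p.55] -/
theorem o1_levels_isGalois (h36 : 𝒢.Prop36Hypotheses) (v₀ : 𝒢.graph.Vertex)
    (hVt : ∀ v : 𝒢.graph.Vertex, IsTopologicallyFinitelyGenerated (𝒢.Gv v))
    (hEt : ∀ e : 𝒢.graph.Edge, IsTopologicallyFinitelyGenerated (𝒢.Ge e)) (n : ℕ) :
    letI := SemiGraphOfAnabelioids.galoisCategory_bObj 𝒢.toAnab ⟨h36.isConnected⟩
    PreGaloisCategory.IsGalois (charCoreObj h36 v₀ hVt hEt n) := by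
  haveI : ∀ k, (charOpenCore (Aut (𝒢.fiberAt v₀)) k).Normal := fun k => charOpenCore_normal k
  exact isGalois_seqObj h36.isConnected v₀ (fun k => charOpenCore (Aut (𝒢.fiberAt v₀)) k)
    (isOpen_charOpenCore_autFiberAt h36 v₀ hVt hEt) (finiteIndex_charOpenCore_autFiberAt h36 v₀ hVt hEt)
    (fun k => charOpenCore_normal k) n

end Literature.IUT.HodgeTheaters.Rmk253
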